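import Summits.ABC.IUTFork.Cor312PinnedThetaRealSharpNegativeCriterionPr
import Summits.ABC.IUTFork.Cor312TameQuadMoverInstance
import HarnessLib

/-!
# [IUTchIII] Cor. 3.12 — PR-1's Θ-pin at the sharp real settings over the ACTUAL field `ℚ(√7)`: a kernel
# negative with NO arithmetic hypothesis left (every pilot datum whose bad set misses `(√7)`)

PROOF-ONLY instance file (0 definitions, 0 named facts; abc-iut cell, WAVE-5 prover seat abc-iut-w5-d044, gen 5; Team R
«ismDH mover» record / branch-C vacuity guard). TAKES NO SIDE on [IUTchIII] Cor. 3.12.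

Composes this seat's `Cor312PinnedThetaRealSharpNegativeCriterion{,Pr}` (p434723/p434871: PR-1's Θ-pin, `PinnedRegions`,
`PinnedRegions3` are unsatisfiable at `Real.settingDHVolSharp` / `Real.settingPrVolSharp` as soon as `F` has ONE place `v₀`
outside the bad fibre with `2 ≤ e(v₀|p₀) ≤ p₀ − 2` over an odd prime — any residue degree) with abc-iut-c312-14 (R1)'s
concrete instance `Cor312TameQuadInstance` (`F7 = ℚ(√7)`, the place `v7 = (√7)` over `7`: `e = 2`, `f = 1`,
`Place.under (inr v7) = 7`, `over_v7`). NEW here (classical, [folklore]): `v7` is the ONLY place of `ℚ(√7)` over `7`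
(`eq_v7_of_residueChar_eq_seven`, from the fundamental identity `Σ e·f = 2` with `e(v7)·f(v7) = 2`), so the hypothesis «no bad
place over `7`» is exactly «`v7 ∉ X.S`».

RESULT: for EVERY pilot datum `X` over `ℚ(√7)` with `v7 ∉ X.S` and ALL structural binders of the sharp settings (ideles,
context binders, columns, region-forming operator `ρ`, q-datum `qK`): `¬ PinnedRegions` and `¬ PinnedRegions3` at
`settingPrVolSharp X …` and at `settingDHVolSharp X …` (`not_pinnedRegions_settingPrVolSharp_F7` &c.). So PR-1's pins DO
have a kernel REFUTATION at an assembled real setting over a concrete number field (abc-iut-w4-d087's p431122 composed with R1's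
instance gives the same at this `e = 2` place; recorded here once, in the general-`e` currency). What this is NOT: a refutation
of branch C's `hPin` binder family — that quantifies over GENUINE Θ-data `T : Cor22.ThetaVolumeDatumAt P l` (initial Θ-data of
[IUTchI] Def. 3.1), and no such datum over a field with a qualifying place is exhibited in the tree; `PilotData ↥F7` is free
data. HONEST SCOPE: OUR interface + OUR sharp real containers under DH's (Ind2) reading (`Aut_{ℚ_p}(K_v : I_v)`); the isometry
reading is untouched; nothing bears on print's (xi-e)/(xi-f). [claim: Mochizuki2012, status: disputed];
[cite: DupuyHilado2025, §4.9]; [cite: ScholzeStix2018, §2.2 pp. 9–10]. Consumed BY NAME, nothing restated. typed ≠ proved.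
-/

noncomputable section

open Metric Set Function
open scoped Pointwise

namespace Summit.ABC.IUTFork.Thm311.Real

open Thm311 Cor312 Cor312Vol Literature.IUT.LogVolume Literature.IUT.LogThetaLattice
open Literature.NumberTheory.NumberFields Literature.NumberTheory.GaloisRepresentations.Ultrametric
open NumberField IsDedekindDomain
open Summit.ABC.IUTFork.RamifiedMover

/-! ## 1. `(√7)` is the only place of `ℚ(√7)` over `7` -/

/-- An ideal of `ℤ` of absolute norm `7` is `(7)`. [folklore] -/
theorem int_ideal_eq_span_seven_of_absNorm {I : Ideal ℤ} (hI : Ideal.absNorm I = 7) : I = Ideal.span {(7 : ℤ)} := by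
  have hg := Ideal.span_singleton_generator I
  set g := Submodule.IsPrincipal.generator I
  rw [← hg] at hI ⊢
  rw [Ideal.absNorm_span_singleton] at hI
  have h7 : g.natAbs = 7 := by simpa using hI
  rcases Int.natAbs_eq g with h | h
  · rw [h, h7]; simp
  · rw [h, h7, Ideal.span_singleton_neg]; simp

/-- **`v7 = (√7)` is the unique place of `ℚ(√7)` over `7`**: any place of `LogVolume`-residue characteristic `7` is `v7`
(the fundamental identity `Σ_{q | 7} e·f = [ℚ(√7):ℚ] = 2` and `e(v7)·f(v7) = 2·1` leave no room for a second prime).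
[folklore] -/
theorem eq_v7_of_residueChar_eq_seven (w : HeightOneSpectrum (𝓞 ↥F7))
    (hw : Literature.IUT.LogVolume.residueChar (↥F7) w = 7) : w = v7 := by
  classical
  have hunder : w.asIdeal.under ℤ = Ideal.span {(7 : ℤ)} := int_ideal_eq_span_seven_of_absNorm hw
  haveI hwover : w.asIdeal.LiesOver (Ideal.span {(7 : ℤ)}) := ⟨hunder.symm⟩
  haveI := v7_liesOver
  by_contra hne
  have hne' : w.asIdeal ≠ v7.asIdeal := fun h => hne (HeightOneSpectrum.ext h)
  haveI hpr : (Ideal.span {(7 : ℤ)}).IsPrime :=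
    (Ideal.span_singleton_prime (by norm_num)).mpr (Int.prime_iff_natAbs_prime.mpr (by norm_num))
  haveI : (Ideal.span {(7 : ℤ)}).IsMaximal :=
    Ideal.IsPrime.isMaximal hpr (by simp only [ne_eq, Ideal.span_singleton_eq_bot]; norm_num)
  haveI : Fintype ((Ideal.span {(7 : ℤ)}).primesOver (𝓞 ↥F7)) :=
    (IsDedekindDomain.primesOver_finite (Ideal.span {(7 : ℤ)}) (𝓞 ↥F7)).fintype
  have hsum := Ideal.sum_ramification_inertia_eq_finrank (p := Ideal.span {(7 : ℤ)}) (S := 𝓞 ↥F7)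
  rw [show Module.finrank ℤ (𝓞 ↥F7) = 2 from by rw [RingOfIntegers.rank]; exact finrank_F7] at hsum
  have hmem7 : v7.asIdeal ∈ (Ideal.span {(7 : ℤ)}).primesOver (𝓞 ↥F7) := ⟨v7.isPrime, v7_liesOver⟩
  have hmemw : w.asIdeal ∈ (Ideal.span {(7 : ℤ)}).primesOver (𝓞 ↥F7) := ⟨w.isPrime, hwover⟩
  -- the two distinct primes contribute `2` and `≥ 1` to a sum equal to `2`
  let f : (Ideal.span {(7 : ℤ)}).primesOver (𝓞 ↥F7) → ℕ := fun q => q.1.ramificationIdx ℤ * q.1.inertiaDeg ℤ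
  have hpair : f ⟨v7.asIdeal, hmem7⟩ + f ⟨w.asIdeal, hmemw⟩ ≤ 2 := by
    rw [← hsum]
    have hsub : ({⟨v7.asIdeal, hmem7⟩, ⟨w.asIdeal, hmemw⟩} :
        Finset ((Ideal.span {(7 : ℤ)}).primesOver (𝓞 ↥F7))) ⊆ Finset.univ := Finset.subset_univ _
    have hne2 : (⟨v7.asIdeal, hmem7⟩ : (Ideal.span {(7 : ℤ)}).primesOver (𝓞 ↥F7)) ≠ ⟨w.asIdeal, hmemw⟩ :=
      fun h => hne' (congrArg Subtype.val h).symm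
    calc f ⟨v7.asIdeal, hmem7⟩ + f ⟨w.asIdeal, hmemw⟩
        = ∑ q ∈ ({⟨v7.asIdeal, hmem7⟩, ⟨w.asIdeal, hmemw⟩} :
            Finset ((Ideal.span {(7 : ℤ)}).primesOver (𝓞 ↥F7))), f q := (Finset.sum_pair hne2).symm
      _ ≤ ∑ q, f q := Finset.sum_le_sum_of_subset_of_nonneg hsub fun _ _ _ => Nat.zero_le _
  have h7 : f ⟨v7.asIdeal, hmem7⟩ = 2 := by
    show v7.asIdeal.ramificationIdx ℤ * v7.asIdeal.inertiaDeg ℤ = 2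
    rw [ramificationIdx_v7, inertiaDeg_v7]
  haveI : w.asIdeal.IsPrime := w.isPrime
  have hwpos : 1 ≤ f ⟨w.asIdeal, hmemw⟩ := by
    show 1 ≤ w.asIdeal.ramificationIdx ℤ * w.asIdeal.inertiaDeg ℤ
    have he : 0 < w.asIdeal.ramificationIdx ℤ := Ideal.ramificationIdx_pos w.asIdeal ℤ
    have hf : 0 < w.asIdeal.inertiaDeg ℤ := Ideal.inertiaDeg_pos w.asIdeal ℤ
    exact Nat.mul_pos he hf
  omega

section F7Instance

variable (X : PilotData ↥F7)
  (M : Type) [Field M] [NumberField M]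
  (archPk : ∀ (j : (thetaIndex X).Label) (vQ : (thetaIndex X).VQ),
    Set ((logShellsDH X (analyticLogv ↥F7)).Packet j vQ))
  (archSub : ∀ (j : (thetaIndex X).Label) (v : (thetaIndex X).V),
    Set ((logShellsDH X (analyticLogv ↥F7)).Packet j ((thetaIndex X).over v)))
  (Ψ : ℤ → ∀ v : (thetaIndex X).V, v ∈ (thetaIndex X).Vbad →
    Set ((logShellsDH X (analyticLogv ↥F7)).StarPacket v))
  (act : ℤ → ∀ v : (thetaIndex X).V, v ∈ (thetaIndex X).Vbad →
    (logShellsDH X (analyticLogv ↥F7)).StarPacket v →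
      Module.End ℚ ((logShellsDH X (analyticLogv ↥F7)).StarPacket v))
  (Mmod : ℤ → ∀ j : (thetaIndex X).LabelStar,
    Set ((logShellsDH X (analyticLogv ↥F7)).GlobalPacket j.1))
  (region : ℤ → ∀ j : (thetaIndex X).LabelStar, FinDivisor M → ∀ vQ : (thetaIndex X).VQ,
    Set ((logShellsDH X (analyticLogv ↥F7)).Packet j.1 vQ))
  (n : ℤ) {HT : Type} {LogLink : HT → HT → Type} {IsFull : ∀ {s t : HT}, LogLink s t → Prop}
  (lat : LGPGaussianLogThetaLattice LogLink IsFull)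
  {Frd : Type} {IsoF : Frd → Frd → Type} {Ob : Frd → Type} {realify : Frd → Frd} {Strip : Type}
  {IsoS : Strip → Strip → Type} {Mv : ∀ v : (thetaIndex X).V, v ∈ (thetaIndex X).Vbad → Type}
  [∀ v h, Monoid (Mv v h)]
  (sig : GlobalLGPFrobenioidSignature (thetaIndex X).lstar (thetaIndex X).V
    (· ∈ (thetaIndex X).Vbad) Frd IsoF Ob realify Strip IsoS Mv)
  (split : SplittingMonoids Mv) {ObΔ : Type}
  {N : ∀ v : (thetaIndex X).V, v ∈ (thetaIndex X).Vbad → Type} [∀ v h, Monoid (N v h)]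
  (qData : QPilotData ObΔ N)
  (tq : ∀ (pp : Nat.Primes) (x : (thetaIndex X).Fibre (.inr pp)),
    haveI : Fact (pp : ℕ).Prime := ⟨pp.2⟩; kOf X pp.1 x)
  (t : ∀ (pp : Nat.Primes) (_ : Fin X.lstar) (x : (thetaIndex X).Fibre (.inr pp)),
    haveI : Fact (pp : ℕ).Prime := ⟨pp.2⟩; kOf X pp.1 x)
  (htq0 : ∀ pp x, tq pp x ≠ 0)
  (htq1 : ∀ (pp : Nat.Primes) (x : (thetaIndex X).Fibre (.inr pp)),
    haveI : Fact (pp : ℕ).Prime := ⟨pp.2⟩; placeOf X pp.1 x ∉ X.S → ‖tq pp x‖ = 1)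
  (col : ℤ → Column (logShellsDH X (analyticLogv ↥F7)))
  (ρ : (∀ v : (thetaIndex X).V, v ∈ (thetaIndex X).Vbad → Set ((logShellsDH X (analyticLogv ↥F7)).StarPacket v)) →
    ∀ (j : (thetaIndex X).Label) (vQ : (thetaIndex X).VQ), Set ((logShellsDH X (analyticLogv ↥F7)).Packet j vQ))
  (qK : ∀ v : (thetaIndex X).V, v ∈ (thetaIndex X).Vbad → Set ((logShellsDH X (analyticLogv ↥F7)).StarPacket v))

/-- «`v7 ∉ X.S`» is «no bad place over `7`» at `ℚ(√7)`. [folklore] -/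
theorem residueChar_ne_seven_of_not_mem (hS : v7 ∉ X.S) :
    ∀ v ∈ X.S, Literature.IUT.LogVolume.residueChar (↥F7) v ≠ ((p7 : ℕ)) := by
  intro v hv h7
  have h7' : Literature.IUT.LogVolume.residueChar (↥F7) v = 7 := by rw [h7]; rfl
  exact hS (eq_v7_of_residueChar_eq_seven v h7' ▸ hv)

/-- **At `F = ℚ(√7)`: PR-1's two pins `PinnedRegions` (branch C's `hPin` shape) FAIL at the print-normalised sharp real setting
`Real.settingPrVolSharp`, for EVERY pilot datum `X` with `v7 ∉ X.S`, every `ρ`, `qK`, all ideles / context binders /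
columns** — `p₀ = 7`, `v₀ = v7`, `e = 2 ∈ [2, 5]`, the over-map identity and «no bad place over 7» all discharged in-kernel.
[cite: DupuyHilado2025, §4.9] [claim: Mochizuki2012, status: disputed] -/
theorem not_pinnedRegions_settingPrVolSharp_F7 (hS : v7 ∉ X.S) :
    ¬ PinnedRegions
        ({ toSituation := situationPrVol X (logvAnalytic_analyticLogv (F := ↥F7)) M archPk archSub Ψ act Mmod region,
           col := col } : LatticeSituation (thetaIndex X))
        (settingPrVolSharp X (logvAnalytic_analyticLogv (F := ↥F7)) M archPk archSub Ψ act Mmod region n lat sig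
          split qData tq t htq0 htq1) ρ qK :=
  not_pinnedRegions_settingPrVolSharp_of_tame_of_residueChar_ne X M archPk archSub Ψ act Mmod region n lat sig split
    qData tq t htq0 htq1 col ρ qK p7 (by norm_num [p7]) v7 (over_v7 X) (by rw [ramificationIdx_v7])
    (by rw [ramificationIdx_v7]; norm_num [p7]) (residueChar_ne_seven_of_not_mem X hS)

/-- … and the three pins `PinnedRegions3` at `Real.settingPrVolSharp` over `ℚ(√7)`. [claim: Mochizuki2012, status: disputed] -/
theorem not_pinnedRegions3_settingPrVolSharp_F7 (hS : v7 ∉ X.S) :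
    ¬ PinnedRegions3
        ({ toSituation := situationPrVol X (logvAnalytic_analyticLogv (F := ↥F7)) M archPk archSub Ψ act Mmod region,
           col := col } : LatticeSituation (thetaIndex X))
        (settingPrVolSharp X (logvAnalytic_analyticLogv (F := ↥F7)) M archPk archSub Ψ act Mmod region n lat sig
          split qData tq t htq0 htq1) ρ qK := fun h =>
  not_pinnedRegions_settingPrVolSharp_F7 X M archPk archSub Ψ act Mmod region n lat sig split qData tq t htq0 htq1 col ρ
    qK hS h.1

/-- **At `F = ℚ(√7)`: `PinnedRegions3` FAILS at the sharp assembled DH setting `Real.settingDHVolSharp`** for every pilot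
datum `X` with `v7 ∉ X.S` (p434723's `not_pinnedRegions3_settingDHVolSharp_of_tame` at `p₀ = 7`, `v₀ = v7`).
[cite: DupuyHilado2025, §4.9] [claim: Mochizuki2012, status: disputed] -/
theorem not_pinnedRegions3_settingDHVolSharp_F7 (hS : v7 ∉ X.S) :
    ¬ PinnedRegions3
        ({ toSituation := situationDHVol X (logvAnalytic_analyticLogv (F := ↥F7)) M archPk archSub Ψ act Mmod region,
           col := col } : LatticeSituation (thetaIndex X))
        (settingDHVolSharp X (logvAnalytic_analyticLogv (F := ↥F7)) M archPk archSub Ψ act Mmod region n lat sig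
          split qData tq t htq0 htq1) ρ qK :=
  not_pinnedRegions3_settingDHVolSharp_of_tame X M archPk archSub Ψ act Mmod region n lat sig split qData tq t htq0
    htq1 col ρ qK p7 (by norm_num [p7]) v7 (over_v7 X) (by rw [ramificationIdx_v7])
    (by rw [ramificationIdx_v7]; norm_num [p7]) (over_ne_of_residueChar_ne X p7 (residueChar_ne_seven_of_not_mem X hS))

end F7Instance

end Summit.ABC.IUTFork.Thm311.Real

end
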